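import Literature.MathematicalPhysics.QuantumFieldTheory.Balaban1983to89.Beta.SquareTableAvgFirst

/-!
# `Balaban1983to89.Beta.WallVolumeTransfer` — THE VOLUME-LIMIT SEAM OF THE SCALAR WALL: volume-uniform graded bounds on
# FINITE-VOLUME (torus) kernels + the pointwise volume limits of (ii-a)/(ii-b) ⟹ the SIX graded `ℤ⁴` binders of
# `SquareTable.endpointExistence_of_scalarBounds` (§14) / `…_avg` (§15) / `SquareTableAvgFirst.…_avgFirst` (cross shapes), SAME constants;
# the torus-distance dictionary; the `ε–L₀ ⟹ Tendsto` conversion; the END statements with finite-volume inputs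

β sub-cell of the audit cell `pub-balaban`, row BETA-an4 (the k-uniform remainder lineage), unit `b2b-balaban-beta-an4` gen 10,
journal claim AN4-WALL-VOLUME-TRANSFER.  The seam is NAMED by the cell lead in BETA-SPEC §7.24 RULING (R13-1)(a) (verbatim):
*«every finite-volume kernel certificate UNIFORM in the (even cubic) volume — `WoodburyFibre`/`WoodburyCovariant`/`LongitudinalWindow`
window bounds against the torus free leg f_𝕋, `SliceLegsScalar` tails, B5 Prop. 1.2-type tails — TRANSFERS to the infinite-volume legs by
`le_of_tendsto` once (ii-a) is kernel; rows keep proving volume-uniform torus bounds; nothing is lost or redone»*, and by `BETA/WALL.md`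
v1.2 §4, row `hF, hG (W2′)₀`: *«the torus-entry ↦ Pt ADAPTER … for the INFINITE-VOLUME vector legs ((R13-1): finite-volume certificates +
(ii-a) entrywise volume limits (an4) + (ii-b) `FreeLegDictionary` KERNEL)»*, owner «an5 successor / an4».  This module types that
transfer ONCE, in the OFFICIAL binder shapes of the third official statement of the wall (RULING (R14-4): `SquareTable` §14/§15), so that
no vector row has to touch a filter: a row proves its graded bounds ON THE TORUS, uniformly (or eventually) in the volume, at the `ℤ⁴`
representative `v` of the displacement; the two pointwise volume limits — of the kernel entries ((ii-a): this lineage's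
`EntrywiseVolumeLimit.tendsto_torusGreen` for the images half, an5's `WoodburySymbol` / `LongitudinalSymbol` `T ↗ ℤ^d` limits for the
Riemann-sum half) and of the torus free leg ((ii-b): an5's `FreeLegDictionary.torusFreeLeg_limit` over lit1's KERNEL
`LatticeGreenRiemannSum.torusGreen_tendsto_latticeGreen`) — are BINDERS here (suppliers named, NOT imported: a socket does not import
its suppliers); the output is the six `ℤ⁴` bounds `h0/h1/h2/d0/d1/d2` with the SAME constants `D_j`, `A_j`, `δ`.

T. Bałaban, *Renormalization group approach to lattice gauge field theories. I*, Commun. Math. Phys. **109**, 249–301 (1987)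
[Balaban1987RG1] (cell paper B12; PDF page = journal page − 248); T. Bałaban, *Propagators and renormalization transformations for
lattice gauge theories. I*, Commun. Math. Phys. **95**, 17–40 (1984) [Balaban1984PropagatorsI] (cell paper B5).

HONEST FRAMING (cell `pub-balaban`, BETA-SPEC, verbatim): discharging `BetaPertH` makes Bałaban's UV stability UNCONDITIONAL — a
real constructive-QFT result; it is NOT the continuum limit and NOT the Clay problem.  THIS MODULE ASSERTS NOTHING about Bałaban's
propagators, nothing about β, and discharges no analytic leaf of the wall: it is [folklore] bookkeeping with Mathlib's filters
(`Filter.Tendsto.sub/add/abs`, `le_of_tendsto`) and `ZMod.valMinAbs`, every hypothesis a binder.  Value = the volume-limit seam between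
the finite-volume certificates of the vector rows and the scalar wall, kernel-checked once; NOT summit progress.

WHAT THE PAPERS PRINT (CONTEXT ONLY; NOTHING IS NEWLY QUOTED — both fragments are the render-checked wordings already carried by
`Beta/InfiniteVolume`, `Beta/LocalizedVolumeRate`, `Beta/EntrywiseVolumeLimit`).  B12 p. 264 [PDF 16], after (1.21): *"Now we take a
limit of these functions as T^{(j+1)} ↗ Z^d. This limit exists by the localized representation (1.7)."*  B5 p. 36 [PDF 20]: *"Probably
the simplest proof of the exponential decay properties can be obtained by relating G on the torus to G on the whole lattice ηZ^d in
the usual way, …"*.  Neither paper prints the passage of UNIFORM BOUNDS to the limit; it is the one-line fact «a closed inequality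
survives a pointwise limit», made explicit below in the wall's shapes.

WHAT THIS MODULE PROVES (zero `sorry`; every theorem [folklore] or a composition by name).
§1  ATOMS along an arbitrary non-trivial filter `l` on the volume index: `abs_lim_le` (`u_t → a`, eventually `|u_t| ≤ c` ⟹ `|a| ≤ c`),
    `abs_lim_sub_le` (`a − b`), `abs_lim_sub_sub_le` (`(a−b)−(c−d)`), `abs_lim_mixed_le` (`a − b − c + d`), `abs_lim_mixed_sub_le`
    (`(a−b)−(c−d)−(e−f)+(g−h)`), `abs_lim_cross_sub_le` (`(a−b)−(c−d)−((e−f)−(g−h))`) — one atom per binder shape of the wall, so that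
    the shape theorems below are one-liners and `exact` unifies with `SquareTable`'s binders verbatim.
§2  THE SIX BINDERS OF §14 FROM FINITE VOLUME (`h0_vol`, `h1_vol`, `h2_vol`, `d0_vol`, `d1_vol`, `d2_vol`): torus-indexed families
    `GT n t : Pt → ℝ` (scale `n`, volume index `t`, read on `ℤ⁴` representatives — the reading is the caller's) and torus free legs
    `gT n t → gFree` pointwise, `GT n t → Gf n` pointwise, and the torus-side bound holding EVENTUALLY in `t` at each fixed `(n, v)` with
    volume-free constants ⟹ the `ℤ⁴` binder for `Gf` with the same constant.  §15 shapes PER BASE POINT `b ∈ Bset n` (`h0_avg_vol` …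
    `d2_avg_vol`) and the average-first CROSS shapes of `SquareTableAvgFirst` (`h1x_vol`, `h2x_vol`, `d1x_vol`, `d2x_vol`; the shift `sh n`
    with `hshB`).  (A bound holding for EVERY volume feeds these by `Filter.Eventually.of_forall`.)
§3  THE TORUS-DISTANCE DICTIONARY.  `perSupNorm N v` = the periodic sup-norm `max_i |valMinAbs (v_i mod N_i)|` of the representative `v` on
    the (possibly anisotropic) torus `Π_i ℤ/N_i` (definitionally the `supNorm ∘ liftZ ∘ castT` of `Beta/VectorTails`, not imported);
    `natAbs_valMinAbs_intCast_eq` (small integers are their own minimal representative, in absolute value; the signed form is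
    the tree's `GreenTao2008.valMinAbs_intCast_of_two_mul_abs_lt`, NOT imported — import hygiene); `perSupNorm_le_supNorm`
    (minimality); `perSupNorm_eq_supNorm` (`= ‖v‖_∞` once `2‖v‖_∞ < N_i` for all `i`); `eventually_perSupNorm_eq` (hence eventually along
    any volume sequence with `N_i → ∞`); `eventually_decay_of_perSupNorm` / `eventually_decay_of_eventually_eq` (a decay certificate
    PHRASED WITH THE TORUS DISTANCE — `A e^{−c ρ_t(v)} ρ_t(v)^{−a}` whenever `ρ_t(v) ≠ 0` — yields the `∀ᶠ` hypothesis of the `d`-theorems at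
    every `v ≠ 0`); `tendsto_of_eps_volume` (the `ε–L₀` form «`∀ ε > 0 ∃ L₀ ∀ t, L₀ ≤ side t → |u_t − a| ≤ ε`» of (ii-b)'s suppliers ⟹
    `Tendsto` along any index filter with `side → ∞`; parity conditions on the volume are the caller's instantiation).
§4  THE END STATEMENTS WITH FINITE-VOLUME INPUTS: `endpointExistence_of_scalarBounds_vol` = `SquareTable.endpointExistence_of_scalarBounds`
    (§14) with `h0…d2` replaced by the torus-side eventually-bounds + the two limit binders; `endpointExistence_of_scalarBounds_avg_vol` =
    the same for §15 (RULING (R13-3), per base point); `endpointExistence_of_scalarBounds_avgFirst_vol` = the same for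
    `SquareTableAvgFirst.endpointExistence_of_scalarBounds_avgFirst` (RULING (R14-6), an3-g7 p183298: eight per-base-point bounds
    `h0/h1/h1x/h2x/d0/d1/d1x/d2x`; the shift structure `(sh, hshB, hwtsh)` is volume-independent data and passes through); every other
    binder verbatim (`hU`, `IdentityForm`, `RemainderConst` / `r ≤ stepBal` (row an4: `RemainderChainTorus.ChainT.abs_beta1_le`), `BetaContH`,
    `BetaUpperH`, `ForwardGenerated`).  IMPORT: `Beta.SquareTableAvgFirst` only (it imports `Beta.SquareTable`; no supplier is imported).
§5  SANITY: constant-in-volume families recover §14's hypotheses (the finite-volume form is not stronger than the `ℤ⁴` form); a numerical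
    instance of the dictionary.

LABELLED INPUTS (binders, used only to the left of `→`; NOT facts): the finite-volume certificates (vector rows an1/an5: torus bounds,
volume-uniform), the entry limits (ii-a) and the free-leg limit (ii-b) — each supplied BY NAME by its owner in the consumer's adapter
file.  CARRIER: any index type and non-trivial filter for the volume (cubic even periods `2t`, towers `L^t`, anisotropic `Π_μ ℤ/N_μ` with
`Filter.atTop` on `Fin 4 → ℕ` all fit); the direction-dependent periods of B12's `T_η` are thus covered HERE (the dictionary §3 is
anisotropic), while the images-half supplier `EntrywiseVolumeLimit` remains cubic (its own located divergence).  ABSOLUTE RULE (cell,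
verbatim): no internally-minted statement may enter as a cited fact; every hypothesis is either kernel-proved in this package or a
verbatim quotation of a PUBLISHED theorem with page reference; the manuscripts under audit are NOT citable for their own disputed steps —
there are NO cited facts in this file (`[cite: …]` tags are provenance / context locators).  Companion prose:
`run/shared/lean/pub/pub-balaban/BETA/ENTRYWISE-VOLUME-LIMIT.md` v1.1 §7; GAPS row C-an4-22.
-/

namespace Literature.MathematicalPhysics.QuantumFieldTheory.Balaban1983to89.Beta.WallVolumeTransfer

open _root_.Filter
open scoped _root_.Topology
open Literature.MathematicalPhysics.QuantumFieldTheory.Balaban1983to89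
open Literature.MathematicalPhysics.QuantumFieldTheory.Balaban1983to89.Beta
open Literature.MathematicalPhysics.QuantumFieldTheory.Balaban1983to89.Beta.DyadicShell (Pt supNorm supNorm_eq_zero_iff natAbs_le_supNorm)
open Literature.MathematicalPhysics.QuantumFieldTheory.Balaban1983to89.Beta.BubbleTransfer (unitVec)
open Literature.MathematicalPhysics.QuantumFieldTheory.Balaban1983to89.Beta.GhostTable (gFree)
open Literature.MathematicalPhysics.QuantumFieldTheory.Balaban1983to89.Beta.SquareTable

/-! ## §1 Atoms: a closed inequality of each wall shape survives a pointwise limit -/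

section Atoms

variable {ι : Type*} {l : Filter ι} [l.NeBot]

/-- **atom (value)**: `u_t → a` and eventually `|u_t| ≤ c` give `|a| ≤ c` (`le_of_tendsto` on `|·|`). [folklore] -/
theorem abs_lim_le {u : ι → ℝ} {a c : ℝ} (hu : Tendsto u l (𝓝 a)) (h : ∀ᶠ t in l, |u t| ≤ c) : |a| ≤ c :=
  le_of_tendsto hu.abs h

/-- **atom (difference `a − b`)** — the shape of `h0` (`G − gFree`), `d1` (first difference) and `h1x`/`d1x` (cross difference). [folklore] -/
theorem abs_lim_sub_le {u₁ u₂ : ι → ℝ} {a₁ a₂ c : ℝ} (h₁ : Tendsto u₁ l (𝓝 a₁)) (h₂ : Tendsto u₂ l (𝓝 a₂))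
    (h : ∀ᶠ t in l, |u₁ t - u₂ t| ≤ c) : |a₁ - a₂| ≤ c :=
  le_of_tendsto (h₁.sub h₂).abs h

/-- **atom (`(a − b) − (c − d)`)** — the shape of `h1` (first difference of `G − gFree`) and `d2x` (cross mixed difference). [folklore] -/
theorem abs_lim_sub_sub_le {u₁ u₂ u₃ u₄ : ι → ℝ} {a₁ a₂ a₃ a₄ c : ℝ} (h₁ : Tendsto u₁ l (𝓝 a₁)) (h₂ : Tendsto u₂ l (𝓝 a₂))
    (h₃ : Tendsto u₃ l (𝓝 a₃)) (h₄ : Tendsto u₄ l (𝓝 a₄)) (h : ∀ᶠ t in l, |u₁ t - u₂ t - (u₃ t - u₄ t)| ≤ c) :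
    |a₁ - a₂ - (a₃ - a₄)| ≤ c :=
  le_of_tendsto ((h₁.sub h₂).sub (h₃.sub h₄)).abs h

/-- **atom (`a − b − c + d`)** — the shape of `d2` (mixed second difference). [folklore] -/
theorem abs_lim_mixed_le {u₁ u₂ u₃ u₄ : ι → ℝ} {a₁ a₂ a₃ a₄ c : ℝ} (h₁ : Tendsto u₁ l (𝓝 a₁)) (h₂ : Tendsto u₂ l (𝓝 a₂))
    (h₃ : Tendsto u₃ l (𝓝 a₃)) (h₄ : Tendsto u₄ l (𝓝 a₄)) (h : ∀ᶠ t in l, |u₁ t - u₂ t - u₃ t + u₄ t| ≤ c) :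
    |a₁ - a₂ - a₃ + a₄| ≤ c :=
  le_of_tendsto (((h₁.sub h₂).sub h₃).add h₄).abs h

/-- **atom (`(a−b) − (c−d) − (e−f) + (g−h)`)** — the shape of `h2` (mixed second difference of `G − gFree`). [folklore] -/
theorem abs_lim_mixed_sub_le {u₁ u₂ u₃ u₄ u₅ u₆ u₇ u₈ : ι → ℝ} {a₁ a₂ a₃ a₄ a₅ a₆ a₇ a₈ c : ℝ}
    (h₁ : Tendsto u₁ l (𝓝 a₁)) (h₂ : Tendsto u₂ l (𝓝 a₂)) (h₃ : Tendsto u₃ l (𝓝 a₃)) (h₄ : Tendsto u₄ l (𝓝 a₄))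
    (h₅ : Tendsto u₅ l (𝓝 a₅)) (h₆ : Tendsto u₆ l (𝓝 a₆)) (h₇ : Tendsto u₇ l (𝓝 a₇)) (h₈ : Tendsto u₈ l (𝓝 a₈))
    (h : ∀ᶠ t in l, |u₁ t - u₂ t - (u₃ t - u₄ t) - (u₅ t - u₆ t) + (u₇ t - u₈ t)| ≤ c) :
    |a₁ - a₂ - (a₃ - a₄) - (a₅ - a₆) + (a₇ - a₈)| ≤ c :=
  le_of_tendsto ((((h₁.sub h₂).sub (h₃.sub h₄)).sub (h₅.sub h₆)).add (h₇.sub h₈)).abs h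

/-- **atom (`(a−b) − (c−d) − ((e−f) − (g−h))`)** — the shape of the average-first `h2x`. [folklore] -/
theorem abs_lim_cross_sub_le {u₁ u₂ u₃ u₄ u₅ u₆ u₇ u₈ : ι → ℝ} {a₁ a₂ a₃ a₄ a₅ a₆ a₇ a₈ c : ℝ}
    (h₁ : Tendsto u₁ l (𝓝 a₁)) (h₂ : Tendsto u₂ l (𝓝 a₂)) (h₃ : Tendsto u₃ l (𝓝 a₃)) (h₄ : Tendsto u₄ l (𝓝 a₄))
    (h₅ : Tendsto u₅ l (𝓝 a₅)) (h₆ : Tendsto u₆ l (𝓝 a₆)) (h₇ : Tendsto u₇ l (𝓝 a₇)) (h₈ : Tendsto u₈ l (𝓝 a₈))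
    (h : ∀ᶠ t in l, |u₁ t - u₂ t - (u₃ t - u₄ t) - (u₅ t - u₆ t - (u₇ t - u₈ t))| ≤ c) :
    |a₁ - a₂ - (a₃ - a₄) - (a₅ - a₆ - (a₇ - a₈))| ≤ c :=
  le_of_tendsto (((h₁.sub h₂).sub (h₃.sub h₄)).sub ((h₅.sub h₆).sub (h₇.sub h₈))).abs h

end Atoms

/-! ## §2 The graded binders of the scalar wall from finite volume -/

section Single

variable {ι : Type*} {l : Filter ι} [l.NeBot] {μ ν : Fin 4}
  {GT gT : ℕ → ι → Pt → ℝ} {Gf : ℕ → Pt → ℝ} {D A : ℕ → ℝ} {δ : ℝ}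

/-- **`h0` FROM FINITE VOLUME**: torus window bound `|G^𝕋_{n,t}(v) − f^𝕋_{n,t}(v)| ≤ D₀/n²` eventually in the volume, `G^𝕋 → G_n`,
`f^𝕋 → gFree` pointwise ⟹ `|G_n(v) − gFree(v)| ≤ D₀/n²` — `SquareTable` §14's `h0` verbatim. [folklore] -/
theorem h0_vol (hG : ∀ n : ℕ, 2 ≤ n → ∀ v, Tendsto (fun t => GT n t v) l (𝓝 (Gf n v)))
    (hg : ∀ n : ℕ, 2 ≤ n → ∀ v, Tendsto (fun t => gT n t v) l (𝓝 (gFree v)))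
    (h0T : ∀ n : ℕ, 2 ≤ n → ∀ v, ∀ᶠ t in l, |GT n t v - gT n t v| ≤ D 0 / (n : ℝ) ^ 2) :
    ∀ n : ℕ, 2 ≤ n → ∀ v, |Gf n v - gFree v| ≤ D 0 / (n : ℝ) ^ 2 :=
  fun n hn v => abs_lim_sub_le (hG n hn v) (hg n hn v) (h0T n hn v)

/-- **`h1` FROM FINITE VOLUME** (first differences of `G − free leg`). [folklore] -/
theorem h1_vol (hG : ∀ n : ℕ, 2 ≤ n → ∀ v, Tendsto (fun t => GT n t v) l (𝓝 (Gf n v)))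
    (hg : ∀ n : ℕ, 2 ≤ n → ∀ v, Tendsto (fun t => gT n t v) l (𝓝 (gFree v)))
    (h1T : ∀ n : ℕ, 2 ≤ n → ∀ v (ρ : Fin 4), ∀ᶠ t in l,
      |(GT n t (v + unitVec ρ) - gT n t (v + unitVec ρ)) - (GT n t v - gT n t v)| ≤ D 1 / (n : ℝ) ^ 3) :
    ∀ n : ℕ, 2 ≤ n → ∀ v (ρ : Fin 4),
      |(Gf n (v + unitVec ρ) - gFree (v + unitVec ρ)) - (Gf n v - gFree v)| ≤ D 1 / (n : ℝ) ^ 3 :=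
  fun n hn v ρ => abs_lim_sub_sub_le (hG n hn _) (hg n hn _) (hG n hn _) (hg n hn _) (h1T n hn v ρ)

/-- **`h2` FROM FINITE VOLUME** (mixed second differences of `G − free leg`). [folklore] -/
theorem h2_vol (hG : ∀ n : ℕ, 2 ≤ n → ∀ v, Tendsto (fun t => GT n t v) l (𝓝 (Gf n v)))
    (hg : ∀ n : ℕ, 2 ≤ n → ∀ v, Tendsto (fun t => gT n t v) l (𝓝 (gFree v)))
    (h2T : ∀ n : ℕ, 2 ≤ n → ∀ v, ∀ᶠ t in l,
      |(GT n t (v + unitVec ν + unitVec μ) - gT n t (v + unitVec ν + unitVec μ)) - (GT n t (v + unitVec ν) - gT n t (v + unitVec ν)) -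
          (GT n t (v + unitVec μ) - gT n t (v + unitVec μ)) + (GT n t v - gT n t v)| ≤ D 2 / (n : ℝ) ^ 4) :
    ∀ n : ℕ, 2 ≤ n → ∀ v,
      |(Gf n (v + unitVec ν + unitVec μ) - gFree (v + unitVec ν + unitVec μ)) - (Gf n (v + unitVec ν) - gFree (v + unitVec ν)) -
          (Gf n (v + unitVec μ) - gFree (v + unitVec μ)) + (Gf n v - gFree v)| ≤ D 2 / (n : ℝ) ^ 4 :=
  fun n hn v => abs_lim_mixed_sub_le (hG n hn _) (hg n hn _) (hG n hn _) (hg n hn _) (hG n hn _) (hg n hn _) (hG n hn _) (hg n hn _)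
    (h2T n hn v)

/-- **`d0` FROM FINITE VOLUME**: the torus decay bound at the representative `v ≠ 0`, eventually in the volume (this is where the torus
distance has become `‖v‖_∞`: §3 `eventually_decay_of_perSupNorm`), ⟹ §14's `d0` verbatim. [folklore] -/
theorem d0_vol (hG : ∀ n : ℕ, 2 ≤ n → ∀ v, Tendsto (fun t => GT n t v) l (𝓝 (Gf n v)))
    (d0T : ∀ n : ℕ, 2 ≤ n → ∀ v : Pt, v ≠ 0 → ∀ᶠ t in l, |GT n t v| ≤ A 0 * Real.exp (-(δ / n) * supNorm v) / (supNorm v : ℝ) ^ 2) :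
    ∀ n : ℕ, 2 ≤ n → ∀ v : Pt, v ≠ 0 → |Gf n v| ≤ A 0 * Real.exp (-(δ / n) * supNorm v) / (supNorm v : ℝ) ^ 2 :=
  fun n hn v hv => abs_lim_le (hG n hn v) (d0T n hn v hv)

/-- **`d1` FROM FINITE VOLUME** (first differences off the origin). [folklore] -/
theorem d1_vol (hG : ∀ n : ℕ, 2 ≤ n → ∀ v, Tendsto (fun t => GT n t v) l (𝓝 (Gf n v)))
    (d1T : ∀ n : ℕ, 2 ≤ n → ∀ v : Pt, v ≠ 0 → ∀ ρ : Fin 4, ∀ᶠ t in l,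
      |GT n t (v + unitVec ρ) - GT n t v| ≤ A 1 * Real.exp (-(δ / n) * supNorm v) / (supNorm v : ℝ) ^ 3) :
    ∀ n : ℕ, 2 ≤ n → ∀ v : Pt, v ≠ 0 → ∀ ρ : Fin 4,
      |Gf n (v + unitVec ρ) - Gf n v| ≤ A 1 * Real.exp (-(δ / n) * supNorm v) / (supNorm v : ℝ) ^ 3 :=
  fun n hn v hv ρ => abs_lim_sub_le (hG n hn _) (hG n hn _) (d1T n hn v hv ρ)

/-- **`d2` FROM FINITE VOLUME** (mixed second differences off the origin). [folklore] -/
theorem d2_vol (hG : ∀ n : ℕ, 2 ≤ n → ∀ v, Tendsto (fun t => GT n t v) l (𝓝 (Gf n v)))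
    (d2T : ∀ n : ℕ, 2 ≤ n → ∀ v : Pt, v ≠ 0 → ∀ᶠ t in l,
      |GT n t (v + unitVec ν + unitVec μ) - GT n t (v + unitVec ν) - GT n t (v + unitVec μ) + GT n t v| ≤
        A 2 * Real.exp (-(δ / n) * supNorm v) / (supNorm v : ℝ) ^ 4) :
    ∀ n : ℕ, 2 ≤ n → ∀ v : Pt, v ≠ 0 →
      |Gf n (v + unitVec ν + unitVec μ) - Gf n (v + unitVec ν) - Gf n (v + unitVec μ) + Gf n v| ≤
        A 2 * Real.exp (-(δ / n) * supNorm v) / (supNorm v : ℝ) ^ 4 :=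
  fun n hn v hv => abs_lim_mixed_le (hG n hn _) (hG n hn _) (hG n hn _) (hG n hn _) (d2T n hn v hv)

end Single

section Avg

variable {ι : Type*} {l : Filter ι} [l.NeBot] {μ ν : Fin 4} {κB : Type*} {Bset : ℕ → Finset κB}
  {GT gT : ℕ → κB → ι → Pt → ℝ} {Gf : ℕ → κB → Pt → ℝ} {D A : ℕ → ℝ} {δ : ℝ} {sh : ℕ → Equiv.Perm κB}

/-- **`h0` PER BASE POINT FROM FINITE VOLUME** (`SquareTable` §15's `h0`; the torus free leg may depend on `b`). [folklore] -/
theorem h0_avg_vol (hG : ∀ n : ℕ, 2 ≤ n → ∀ b ∈ Bset n, ∀ v, Tendsto (fun t => GT n b t v) l (𝓝 (Gf n b v)))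
    (hg : ∀ n : ℕ, 2 ≤ n → ∀ b ∈ Bset n, ∀ v, Tendsto (fun t => gT n b t v) l (𝓝 (gFree v)))
    (h0T : ∀ n : ℕ, 2 ≤ n → ∀ b ∈ Bset n, ∀ v, ∀ᶠ t in l, |GT n b t v - gT n b t v| ≤ D 0 / (n : ℝ) ^ 2) :
    ∀ n : ℕ, 2 ≤ n → ∀ b ∈ Bset n, ∀ v, |Gf n b v - gFree v| ≤ D 0 / (n : ℝ) ^ 2 :=
  fun n hn b hb v => abs_lim_sub_le (hG n hn b hb v) (hg n hn b hb v) (h0T n hn b hb v)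

/-- **`h1` PER BASE POINT FROM FINITE VOLUME**. [folklore] -/
theorem h1_avg_vol (hG : ∀ n : ℕ, 2 ≤ n → ∀ b ∈ Bset n, ∀ v, Tendsto (fun t => GT n b t v) l (𝓝 (Gf n b v)))
    (hg : ∀ n : ℕ, 2 ≤ n → ∀ b ∈ Bset n, ∀ v, Tendsto (fun t => gT n b t v) l (𝓝 (gFree v)))
    (h1T : ∀ n : ℕ, 2 ≤ n → ∀ b ∈ Bset n, ∀ v (ρ : Fin 4), ∀ᶠ t in l,
      |(GT n b t (v + unitVec ρ) - gT n b t (v + unitVec ρ)) - (GT n b t v - gT n b t v)| ≤ D 1 / (n : ℝ) ^ 3) :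
    ∀ n : ℕ, 2 ≤ n → ∀ b ∈ Bset n, ∀ v (ρ : Fin 4),
      |(Gf n b (v + unitVec ρ) - gFree (v + unitVec ρ)) - (Gf n b v - gFree v)| ≤ D 1 / (n : ℝ) ^ 3 :=
  fun n hn b hb v ρ => abs_lim_sub_sub_le (hG n hn b hb _) (hg n hn b hb _) (hG n hn b hb _) (hg n hn b hb _) (h1T n hn b hb v ρ)

/-- **`h2` PER BASE POINT FROM FINITE VOLUME**. [folklore] -/
theorem h2_avg_vol (hG : ∀ n : ℕ, 2 ≤ n → ∀ b ∈ Bset n, ∀ v, Tendsto (fun t => GT n b t v) l (𝓝 (Gf n b v)))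
    (hg : ∀ n : ℕ, 2 ≤ n → ∀ b ∈ Bset n, ∀ v, Tendsto (fun t => gT n b t v) l (𝓝 (gFree v)))
    (h2T : ∀ n : ℕ, 2 ≤ n → ∀ b ∈ Bset n, ∀ v, ∀ᶠ t in l,
      |(GT n b t (v + unitVec ν + unitVec μ) - gT n b t (v + unitVec ν + unitVec μ)) -
          (GT n b t (v + unitVec ν) - gT n b t (v + unitVec ν)) - (GT n b t (v + unitVec μ) - gT n b t (v + unitVec μ)) +
          (GT n b t v - gT n b t v)| ≤ D 2 / (n : ℝ) ^ 4) :
    ∀ n : ℕ, 2 ≤ n → ∀ b ∈ Bset n, ∀ v,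
      |(Gf n b (v + unitVec ν + unitVec μ) - gFree (v + unitVec ν + unitVec μ)) - (Gf n b (v + unitVec ν) - gFree (v + unitVec ν)) -
          (Gf n b (v + unitVec μ) - gFree (v + unitVec μ)) + (Gf n b v - gFree v)| ≤ D 2 / (n : ℝ) ^ 4 :=
  fun n hn b hb v => abs_lim_mixed_sub_le (hG n hn b hb _) (hg n hn b hb _) (hG n hn b hb _) (hg n hn b hb _) (hG n hn b hb _)
    (hg n hn b hb _) (hG n hn b hb _) (hg n hn b hb _) (h2T n hn b hb v)

/-- **`d0` PER BASE POINT FROM FINITE VOLUME**. [folklore] -/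
theorem d0_avg_vol (hG : ∀ n : ℕ, 2 ≤ n → ∀ b ∈ Bset n, ∀ v, Tendsto (fun t => GT n b t v) l (𝓝 (Gf n b v)))
    (d0T : ∀ n : ℕ, 2 ≤ n → ∀ b ∈ Bset n, ∀ v : Pt, v ≠ 0 → ∀ᶠ t in l,
      |GT n b t v| ≤ A 0 * Real.exp (-(δ / n) * supNorm v) / (supNorm v : ℝ) ^ 2) :
    ∀ n : ℕ, 2 ≤ n → ∀ b ∈ Bset n, ∀ v : Pt, v ≠ 0 → |Gf n b v| ≤ A 0 * Real.exp (-(δ / n) * supNorm v) / (supNorm v : ℝ) ^ 2 :=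
  fun n hn b hb v hv => abs_lim_le (hG n hn b hb v) (d0T n hn b hb v hv)

/-- **`d1` PER BASE POINT FROM FINITE VOLUME**. [folklore] -/
theorem d1_avg_vol (hG : ∀ n : ℕ, 2 ≤ n → ∀ b ∈ Bset n, ∀ v, Tendsto (fun t => GT n b t v) l (𝓝 (Gf n b v)))
    (d1T : ∀ n : ℕ, 2 ≤ n → ∀ b ∈ Bset n, ∀ v : Pt, v ≠ 0 → ∀ ρ : Fin 4, ∀ᶠ t in l,
      |GT n b t (v + unitVec ρ) - GT n b t v| ≤ A 1 * Real.exp (-(δ / n) * supNorm v) / (supNorm v : ℝ) ^ 3) :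
    ∀ n : ℕ, 2 ≤ n → ∀ b ∈ Bset n, ∀ v : Pt, v ≠ 0 → ∀ ρ : Fin 4,
      |Gf n b (v + unitVec ρ) - Gf n b v| ≤ A 1 * Real.exp (-(δ / n) * supNorm v) / (supNorm v : ℝ) ^ 3 :=
  fun n hn b hb v hv ρ => abs_lim_sub_le (hG n hn b hb _) (hG n hn b hb _) (d1T n hn b hb v hv ρ)

/-- **`d2` PER BASE POINT FROM FINITE VOLUME**. [folklore] -/
theorem d2_avg_vol (hG : ∀ n : ℕ, 2 ≤ n → ∀ b ∈ Bset n, ∀ v, Tendsto (fun t => GT n b t v) l (𝓝 (Gf n b v)))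
    (d2T : ∀ n : ℕ, 2 ≤ n → ∀ b ∈ Bset n, ∀ v : Pt, v ≠ 0 → ∀ᶠ t in l,
      |GT n b t (v + unitVec ν + unitVec μ) - GT n b t (v + unitVec ν) - GT n b t (v + unitVec μ) + GT n b t v| ≤
        A 2 * Real.exp (-(δ / n) * supNorm v) / (supNorm v : ℝ) ^ 4) :
    ∀ n : ℕ, 2 ≤ n → ∀ b ∈ Bset n, ∀ v : Pt, v ≠ 0 →
      |Gf n b (v + unitVec ν + unitVec μ) - Gf n b (v + unitVec ν) - Gf n b (v + unitVec μ) + Gf n b v| ≤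
        A 2 * Real.exp (-(δ / n) * supNorm v) / (supNorm v : ℝ) ^ 4 :=
  fun n hn b hb v hv => abs_lim_mixed_le (hG n hn b hb _) (hG n hn b hb _) (hG n hn b hb _) (hG n hn b hb _) (d2T n hn b hb v hv)

/-! ### The average-first CROSS shapes (`SquareTableAvgFirst`: `h1x`, `h2x`, `d1x`, `d2x`; shift `sh n : Equiv.Perm κB` preserving `Bset n`) -/

/-- **`h1x` FROM FINITE VOLUME** (cross-base-point difference in the window). [folklore] -/
theorem h1x_vol (hshB : ∀ n : ℕ, 2 ≤ n → ∀ b, sh n b ∈ Bset n ↔ b ∈ Bset n)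
    (hG : ∀ n : ℕ, 2 ≤ n → ∀ b ∈ Bset n, ∀ v, Tendsto (fun t => GT n b t v) l (𝓝 (Gf n b v)))
    (h1xT : ∀ n : ℕ, 2 ≤ n → ∀ b ∈ Bset n, ∀ v, ∀ᶠ t in l, |GT n (sh n b) t v - GT n b t v| ≤ D 3 / (n : ℝ) ^ 3) :
    ∀ n : ℕ, 2 ≤ n → ∀ b ∈ Bset n, ∀ v, |Gf n (sh n b) v - Gf n b v| ≤ D 3 / (n : ℝ) ^ 3 :=
  fun n hn b hb v => abs_lim_sub_le (hG n hn _ ((hshB n hn b).2 hb) _) (hG n hn b hb _) (h1xT n hn b hb v)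

/-- **`h2x` FROM FINITE VOLUME** (cross mixed second difference of `G − free leg`). [folklore] -/
theorem h2x_vol (hshB : ∀ n : ℕ, 2 ≤ n → ∀ b, sh n b ∈ Bset n ↔ b ∈ Bset n)
    (hG : ∀ n : ℕ, 2 ≤ n → ∀ b ∈ Bset n, ∀ v, Tendsto (fun t => GT n b t v) l (𝓝 (Gf n b v)))
    (hg : ∀ n : ℕ, 2 ≤ n → ∀ b ∈ Bset n, ∀ v, Tendsto (fun t => gT n b t v) l (𝓝 (gFree v)))
    (h2xT : ∀ n : ℕ, 2 ≤ n → ∀ b ∈ Bset n, ∀ v, ∀ᶠ t in l,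
      |(GT n b t (v + unitVec μ + unitVec ν) - gT n b t (v + unitVec μ + unitVec ν)) -
          (GT n b t (v + unitVec μ) - gT n b t (v + unitVec μ)) -
          ((GT n (sh n b) t (v + unitVec ν) - gT n (sh n b) t (v + unitVec ν)) - (GT n (sh n b) t v - gT n (sh n b) t v))| ≤
        D 2 / (n : ℝ) ^ 4) :
    ∀ n : ℕ, 2 ≤ n → ∀ b ∈ Bset n, ∀ v,
      |(Gf n b (v + unitVec μ + unitVec ν) - gFree (v + unitVec μ + unitVec ν)) - (Gf n b (v + unitVec μ) - gFree (v + unitVec μ)) -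
          ((Gf n (sh n b) (v + unitVec ν) - gFree (v + unitVec ν)) - (Gf n (sh n b) v - gFree v))| ≤ D 2 / (n : ℝ) ^ 4 :=
  fun n hn b hb v =>
    have hb' : sh n b ∈ Bset n := (hshB n hn b).2 hb
    abs_lim_cross_sub_le (hG n hn b hb _) (hg n hn b hb _) (hG n hn b hb _) (hg n hn b hb _) (hG n hn _ hb' _) (hg n hn _ hb' _)
      (hG n hn _ hb' _) (hg n hn _ hb' _) (h2xT n hn b hb v)

/-- **`d1x` FROM FINITE VOLUME** (cross-base-point difference off the origin). [folklore] -/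
theorem d1x_vol (hshB : ∀ n : ℕ, 2 ≤ n → ∀ b, sh n b ∈ Bset n ↔ b ∈ Bset n)
    (hG : ∀ n : ℕ, 2 ≤ n → ∀ b ∈ Bset n, ∀ v, Tendsto (fun t => GT n b t v) l (𝓝 (Gf n b v)))
    (d1xT : ∀ n : ℕ, 2 ≤ n → ∀ b ∈ Bset n, ∀ v : Pt, v ≠ 0 → ∀ᶠ t in l,
      |GT n (sh n b) t v - GT n b t v| ≤ A 3 * Real.exp (-(δ / n) * supNorm v) / (supNorm v : ℝ) ^ 3) :
    ∀ n : ℕ, 2 ≤ n → ∀ b ∈ Bset n, ∀ v : Pt, v ≠ 0 →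
      |Gf n (sh n b) v - Gf n b v| ≤ A 3 * Real.exp (-(δ / n) * supNorm v) / (supNorm v : ℝ) ^ 3 :=
  fun n hn b hb v hv => abs_lim_sub_le (hG n hn _ ((hshB n hn b).2 hb) _) (hG n hn b hb _) (d1xT n hn b hb v hv)

/-- **`d2x` FROM FINITE VOLUME** (cross mixed second difference off the origin). [folklore] -/
theorem d2x_vol (hshB : ∀ n : ℕ, 2 ≤ n → ∀ b, sh n b ∈ Bset n ↔ b ∈ Bset n)
    (hG : ∀ n : ℕ, 2 ≤ n → ∀ b ∈ Bset n, ∀ v, Tendsto (fun t => GT n b t v) l (𝓝 (Gf n b v)))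
    (d2xT : ∀ n : ℕ, 2 ≤ n → ∀ b ∈ Bset n, ∀ v : Pt, v ≠ 0 → ∀ᶠ t in l,
      |GT n b t (v + unitVec μ + unitVec ν) - GT n b t (v + unitVec μ) - (GT n (sh n b) t (v + unitVec ν) - GT n (sh n b) t v)| ≤
        A 2 * Real.exp (-(δ / n) * supNorm v) / (supNorm v : ℝ) ^ 4) :
    ∀ n : ℕ, 2 ≤ n → ∀ b ∈ Bset n, ∀ v : Pt, v ≠ 0 →
      |Gf n b (v + unitVec μ + unitVec ν) - Gf n b (v + unitVec μ) - (Gf n (sh n b) (v + unitVec ν) - Gf n (sh n b) v)| ≤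
        A 2 * Real.exp (-(δ / n) * supNorm v) / (supNorm v : ℝ) ^ 4 :=
  fun n hn b hb v hv =>
    have hb' : sh n b ∈ Bset n := (hshB n hn b).2 hb
    abs_lim_sub_sub_le (hG n hn b hb _) (hG n hn b hb _) (hG n hn _ hb' _) (hG n hn _ hb' _) (d2xT n hn b hb v hv)

end Avg

/-! ## §3 The torus-distance dictionary and the `ε–L₀` conversion -/

section TorusDistance

/-- **Small integers are their own minimal representative, in absolute value**: `|valMinAbs (x mod s)| = |x|` (as natural
numbers) whenever `2|x| < s`.  (The signed form `valMinAbs (x mod s) = x` is already in the tree as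
`Literature.NumberTheory.Sieve.GreenTao2008.valMinAbs_intCast_of_two_mul_abs_lt`; that module is deliberately NOT imported — it
would pull the Green–Tao sieve stack into the `Beta/` import closure — so the three-line `ZMod.valMinAbs_spec` argument is inlined
as a `have` below and no signed-form declaration is made here.) [folklore] -/
theorem natAbs_valMinAbs_intCast_eq {s : ℕ} [NeZero s] {x : ℤ} (h : 2 * x.natAbs < s) :
    (((x : ZMod s)).valMinAbs).natAbs = x.natAbs := by
  have h' : 2 * |x| < (s : ℤ) := by
    rw [← Int.natCast_natAbs]; exact_mod_cast h
  have hx : ((x : ZMod s)).valMinAbs = x := by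
    rw [ZMod.valMinAbs_spec]
    refine ⟨rfl, ?_, ?_⟩
    · linarith [neg_abs_le x, abs_nonneg x]
    · linarith [le_abs_self x]
  rw [hx]

/-- **THE PERIODIC SUP-NORM** of the representative `v ∈ ℤ⁴` on the torus `Π_i ℤ/N_i`: `max_i |valMinAbs (v_i mod N_i)|` — the torus
sup-distance from `[v]` to `0` (definitionally `supNorm (liftZ (castT N v))` of `Beta/VectorTails`, by `liftZ z μ = (z μ).valMinAbs`). [folklore] -/
def perSupNorm (N : Fin 4 → ℕ) (v : Pt) : ℕ := Finset.univ.sup fun i => (((v i : ℤ) : ZMod (N i)).valMinAbs).natAbs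

/-- **Minimality**: the periodic sup-norm never exceeds the sup-norm of the representative. [folklore] -/
theorem perSupNorm_le_supNorm (N : Fin 4 → ℕ) [∀ i, NeZero (N i)] (v : Pt) : perSupNorm N v ≤ supNorm v := by
  unfold perSupNorm supNorm
  exact Finset.sup_mono_fun fun i _ =>
    ZMod.natAbs_min_of_le_div_two (N i) _ (v i) (ZMod.coe_valMinAbs _) (ZMod.natAbs_valMinAbs_le _)

/-- **IN THE FUNDAMENTAL WINDOW THE TWO NORMS AGREE**: `perSupNorm N v = ‖v‖_∞` once `2‖v‖_∞ < N_i` for every `i`. [folklore] -/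
theorem perSupNorm_eq_supNorm {N : Fin 4 → ℕ} {v : Pt} (h : ∀ i, 2 * supNorm v < N i) : perSupNorm N v = supNorm v := by
  unfold perSupNorm supNorm
  refine Finset.sup_congr rfl fun i _ => ?_
  haveI : NeZero (N i) := ⟨by have := h i; omega⟩
  exact natAbs_valMinAbs_intCast_eq (lt_of_le_of_lt (Nat.mul_le_mul_left 2 (natAbs_le_supNorm v i)) (h i))

/-- **EVENTUALLY, ALONG ANY VOLUME SEQUENCE WITH `N_i → ∞`, THE TORUS DISTANCE OF `[v]` IS `‖v‖_∞`** (fixed `v`). [folklore] -/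
theorem eventually_perSupNorm_eq {ι : Type*} {l : Filter ι} {N : ι → Fin 4 → ℕ} (hN : ∀ i, Tendsto (fun t => N t i) l atTop)
    (v : Pt) : ∀ᶠ t in l, perSupNorm (N t) v = supNorm v := by
  have h : ∀ i, ∀ᶠ t in l, 2 * supNorm v < N t i := fun i => (hN i).eventually_gt_atTop _
  filter_upwards [Filter.eventually_all.2 h] with t ht
  exact perSupNorm_eq_supNorm ht

/-- **A DECAY CERTIFICATE PHRASED WITH THE TORUS DISTANCE YIELDS THE `∀ᶠ` HYPOTHESIS OF THE `d`-THEOREMS** (abstract distance `ρ_t`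
agreeing with `‖v‖_∞` eventually — e.g. `B12Decay510Torus.pl1`-type or `VectorTailsCov.tdist`-type distances by their own window lemmas). [folklore] -/
theorem eventually_decay_of_eventually_eq {ι : Type*} {l : Filter ι} {ρ : ι → ℕ} {u : ι → ℝ} {A c : ℝ} {a : ℕ} {v : Pt}
    (hv : v ≠ 0) (hρ : ∀ᶠ t in l, ρ t = supNorm v)
    (h : ∀ᶠ t in l, ρ t ≠ 0 → |u t| ≤ A * Real.exp (-c * ρ t) / (ρ t : ℝ) ^ a) :
    ∀ᶠ t in l, |u t| ≤ A * Real.exp (-c * supNorm v) / (supNorm v : ℝ) ^ a := by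
  filter_upwards [hρ, h] with t ht h'
  rw [ht] at h'
  exact h' fun h0 => hv (supNorm_eq_zero_iff.1 h0)

/-- **THE SAME WITH THE PERIODIC SUP-NORM** along a volume sequence `N_i → ∞`. [folklore] -/
theorem eventually_decay_of_perSupNorm {ι : Type*} {l : Filter ι} {N : ι → Fin 4 → ℕ} (hN : ∀ i, Tendsto (fun t => N t i) l atTop)
    {u : ι → ℝ} {A c : ℝ} {a : ℕ} {v : Pt} (hv : v ≠ 0)
    (h : ∀ᶠ t in l, perSupNorm (N t) v ≠ 0 → |u t| ≤ A * Real.exp (-c * perSupNorm (N t) v) / (perSupNorm (N t) v : ℝ) ^ a) :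
    ∀ᶠ t in l, |u t| ≤ A * Real.exp (-c * supNorm v) / (supNorm v : ℝ) ^ a :=
  eventually_decay_of_eventually_eq hv (eventually_perSupNorm_eq hN v) h

/-- **`ε–L₀` ⟹ `Tendsto`**: a limit stated as «for every `ε > 0` there is `L₀` with `|u_t − a| ≤ ε` whenever the volume `side t ≥ L₀`»
(the form of (ii-b)'s suppliers, e.g. `FreeLegDictionary.torusFreeLeg_limit`, lit1's `torusGreen_tendsto_latticeGreen`; parity or
divisibility conditions on the volume are discharged by the caller's choice of the sequence `side`) is a `Tendsto` along any index
filter with `side → ∞`. [folklore] -/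
theorem tendsto_of_eps_volume {ι : Type*} {l : Filter ι} {side : ι → ℕ} (hside : Tendsto side l atTop) {u : ι → ℝ} {a : ℝ}
    (h : ∀ ε > 0, ∃ L₀ : ℕ, ∀ t, L₀ ≤ side t → |u t - a| ≤ ε) : Tendsto u l (𝓝 a) := by
  rw [Metric.tendsto_nhds]
  intro ε hε
  obtain ⟨L₀, hL⟩ := h (ε / 2) (half_pos hε)
  filter_upwards [hside.eventually_ge_atTop L₀] with t ht
  rw [Real.dist_eq]
  exact (hL t ht).trans_lt (half_lt_self hε)

end TorusDistance

/-! ## §4 The END statements of the scalar wall with FINITE-VOLUME inputs -/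

section EndToEnd

variable {ι : Type*} {l : Filter ι} [l.NeBot] {μ ν : Fin 4}

open FlowStep DagBinding
open Literature.MathematicalPhysics.QuantumFieldTheory.Balaban1983to89.Beta.MarginalTelescoping (composedCoeff IdentityForm)
open Literature.MathematicalPhysics.QuantumFieldTheory.Balaban1983to89.Beta.RemainderChain (RemainderConst)
open Literature.MathematicalPhysics.QuantumFieldTheory.Balaban1983to89.Beta.WindowIdentification (fullSum)
open Literature.MathematicalPhysics.QuantumFieldTheory.Balaban1983to89.Beta.SquareTableAvgFirst (endpointExistence_of_scalarBounds_avgFirst)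

/-- **`EndpointExistence` FROM THE SCALAR WALL WITH FINITE-VOLUME GRADED BOUNDS** — `SquareTable.endpointExistence_of_scalarBounds` (§14)
with its six `ℤ⁴` bounds `h0…d2` REPLACED by: torus-indexed families `GT n t` (kernel entries read on representatives) and `gT n t` (torus
free legs), their pointwise volume limits `GT n t → Gf n` ((ii-a)) and `gT n t → gFree` ((ii-b)) along a non-trivial filter `l`, and the six
graded bounds ON THE TORUS SIDE holding eventually in the volume at each fixed `(n, v)` with volume-free constants.  Every other binder of
§14 verbatim (window data, `hU`, `IdentityForm`, row an4's `RemainderConst`/`r ≤ stepBal`, `BetaContH`, `BetaUpperH`, `ForwardGenerated`).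
Composition BY NAME; nothing of Bałaban's series is asserted. [folklore] -/
theorem endpointExistence_of_scalarBounds_vol {β : HBeta} {Cn : B12.Construction} (hgen : ForwardGenerated Cn β)
    (S : B12Beta.OneLoopSplit β) (hμν : μ ≠ ν) {N : ℝ} (hN : N ≠ 0)
    {Lc : ℕ} (hL : 2 ≤ Lc) {μC : ℕ → ℕ → ℝ} {GT gT : ℕ → ι → Pt → ℝ} {Gf : ℕ → Pt → ℝ} {D A : ℕ → ℝ}
    (hD : ∀ j, 0 ≤ D j) (hA : ∀ j, 0 ≤ A j) {δ U cc : ℝ} {M : ℕ → ℕ} (hδ : 0 < δ)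
    (hc : 1 ≤ cc) (hM : ∀ L : ℕ, 2 ≤ L → 1 ≤ M L ∧ (L : ℝ) ≤ cc * M L) (hML : ∀ L : ℕ, 2 ≤ L → M L ≤ L)
    (hG : ∀ n : ℕ, 2 ≤ n → ∀ v, Tendsto (fun t => GT n t v) l (𝓝 (Gf n v)))
    (hg : ∀ n : ℕ, 2 ≤ n → ∀ v, Tendsto (fun t => gT n t v) l (𝓝 (gFree v)))
    (h0T : ∀ n : ℕ, 2 ≤ n → ∀ v, ∀ᶠ t in l, |GT n t v - gT n t v| ≤ D 0 / (n : ℝ) ^ 2)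
    (h1T : ∀ n : ℕ, 2 ≤ n → ∀ v (ρ : Fin 4), ∀ᶠ t in l,
      |(GT n t (v + unitVec ρ) - gT n t (v + unitVec ρ)) - (GT n t v - gT n t v)| ≤ D 1 / (n : ℝ) ^ 3)
    (h2T : ∀ n : ℕ, 2 ≤ n → ∀ v, ∀ᶠ t in l,
      |(GT n t (v + unitVec ν + unitVec μ) - gT n t (v + unitVec ν + unitVec μ)) - (GT n t (v + unitVec ν) - gT n t (v + unitVec ν)) -
          (GT n t (v + unitVec μ) - gT n t (v + unitVec μ)) + (GT n t v - gT n t v)| ≤ D 2 / (n : ℝ) ^ 4)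
    (d0T : ∀ n : ℕ, 2 ≤ n → ∀ v : Pt, v ≠ 0 → ∀ᶠ t in l, |GT n t v| ≤ A 0 * Real.exp (-(δ / n) * supNorm v) / (supNorm v : ℝ) ^ 2)
    (d1T : ∀ n : ℕ, 2 ≤ n → ∀ v : Pt, v ≠ 0 → ∀ ρ : Fin 4, ∀ᶠ t in l,
      |GT n t (v + unitVec ρ) - GT n t v| ≤ A 1 * Real.exp (-(δ / n) * supNorm v) / (supNorm v : ℝ) ^ 3)
    (d2T : ∀ n : ℕ, 2 ≤ n → ∀ v : Pt, v ≠ 0 → ∀ᶠ t in l,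
      |GT n t (v + unitVec ν + unitVec μ) - GT n t (v + unitVec ν) - GT n t (v + unitVec μ) + GT n t v| ≤
        A 2 * Real.exp (-(δ / n) * supNorm v) / (supNorm v : ℝ) ^ 4)
    (hU : ∀ m : ℕ, 1 ≤ m → |composedCoeff μC m - fullSum (stK μ ν N (Gf (Lc ^ m)))| ≤ U)
    (hid : IdentityForm μC S.β0)
    {rr γ₀ β' : ℝ} (hγ₀ : 0 < γ₀) (hrem : RemainderConst S γ₀ rr) (hr : rr ≤ B12Normalization.stepBal N Lc)
    (hβ' : 0 ≤ β') (hcont : BetaContH γ₀ β) (hup : BetaUpperH β' γ₀ β) : EndpointExistence Cn :=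
  endpointExistence_of_scalarBounds hgen S hμν hN hL hD hA hδ hc hM hML (h0_vol hG hg h0T) (h1_vol hG hg h1T) (h2_vol hG hg h2T)
    (d0_vol hG d0T) (d1_vol hG d1T) (d2_vol hG d2T) hU hid hγ₀ hrem hr hβ' hcont hup

variable {κB : Type*}

/-- **`EndpointExistence` FROM THE BASE-POINT-AVERAGED SCALAR WALL WITH FINITE-VOLUME GRADED BOUNDS** (RULING (R13-3)) —
`SquareTable.endpointExistence_of_scalarBounds_avg` (§15) with the six per-base-point `ℤ⁴` bounds replaced by their finite-volume form
(`h0_avg_vol` … `d2_avg_vol`); every other binder verbatim. [folklore] -/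
theorem endpointExistence_of_scalarBounds_avg_vol {β : HBeta} {Cn : B12.Construction} (hgen : ForwardGenerated Cn β)
    (S : B12Beta.OneLoopSplit β) (hμν : μ ≠ ν) {N : ℝ} (hN : N ≠ 0)
    {Lc : ℕ} (hL : 2 ≤ Lc) {μC : ℕ → ℕ → ℝ} {Bset : ℕ → Finset κB} {wt : ℕ → κB → ℝ}
    {GT gT : ℕ → κB → ι → Pt → ℝ} {Gf : ℕ → κB → Pt → ℝ} {D A : ℕ → ℝ}
    (hD : ∀ j, 0 ≤ D j) (hA : ∀ j, 0 ≤ A j) {δ U cc : ℝ} {M : ℕ → ℕ} (hδ : 0 < δ)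
    (hwt0 : ∀ n : ℕ, 2 ≤ n → ∀ b ∈ Bset n, 0 ≤ wt n b) (hwt1 : ∀ n : ℕ, 2 ≤ n → ∑ b ∈ Bset n, wt n b = 1)
    (hc : 1 ≤ cc) (hM : ∀ L : ℕ, 2 ≤ L → 1 ≤ M L ∧ (L : ℝ) ≤ cc * M L) (hML : ∀ L : ℕ, 2 ≤ L → M L ≤ L)
    (hG : ∀ n : ℕ, 2 ≤ n → ∀ b ∈ Bset n, ∀ v, Tendsto (fun t => GT n b t v) l (𝓝 (Gf n b v)))
    (hg : ∀ n : ℕ, 2 ≤ n → ∀ b ∈ Bset n, ∀ v, Tendsto (fun t => gT n b t v) l (𝓝 (gFree v)))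
    (h0T : ∀ n : ℕ, 2 ≤ n → ∀ b ∈ Bset n, ∀ v, ∀ᶠ t in l, |GT n b t v - gT n b t v| ≤ D 0 / (n : ℝ) ^ 2)
    (h1T : ∀ n : ℕ, 2 ≤ n → ∀ b ∈ Bset n, ∀ v (ρ : Fin 4), ∀ᶠ t in l,
      |(GT n b t (v + unitVec ρ) - gT n b t (v + unitVec ρ)) - (GT n b t v - gT n b t v)| ≤ D 1 / (n : ℝ) ^ 3)
    (h2T : ∀ n : ℕ, 2 ≤ n → ∀ b ∈ Bset n, ∀ v, ∀ᶠ t in l,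
      |(GT n b t (v + unitVec ν + unitVec μ) - gT n b t (v + unitVec ν + unitVec μ)) -
          (GT n b t (v + unitVec ν) - gT n b t (v + unitVec ν)) - (GT n b t (v + unitVec μ) - gT n b t (v + unitVec μ)) +
          (GT n b t v - gT n b t v)| ≤ D 2 / (n : ℝ) ^ 4)
    (d0T : ∀ n : ℕ, 2 ≤ n → ∀ b ∈ Bset n, ∀ v : Pt, v ≠ 0 → ∀ᶠ t in l,
      |GT n b t v| ≤ A 0 * Real.exp (-(δ / n) * supNorm v) / (supNorm v : ℝ) ^ 2)
    (d1T : ∀ n : ℕ, 2 ≤ n → ∀ b ∈ Bset n, ∀ v : Pt, v ≠ 0 → ∀ ρ : Fin 4, ∀ᶠ t in l,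
      |GT n b t (v + unitVec ρ) - GT n b t v| ≤ A 1 * Real.exp (-(δ / n) * supNorm v) / (supNorm v : ℝ) ^ 3)
    (d2T : ∀ n : ℕ, 2 ≤ n → ∀ b ∈ Bset n, ∀ v : Pt, v ≠ 0 → ∀ᶠ t in l,
      |GT n b t (v + unitVec ν + unitVec μ) - GT n b t (v + unitVec ν) - GT n b t (v + unitVec μ) + GT n b t v| ≤
        A 2 * Real.exp (-(δ / n) * supNorm v) / (supNorm v : ℝ) ^ 4)
    (hU : ∀ m : ℕ, 1 ≤ m → |composedCoeff μC m - ∑ b ∈ Bset (Lc ^ m), wt (Lc ^ m) b * fullSum (stK μ ν N (Gf (Lc ^ m) b))| ≤ U)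
    (hid : IdentityForm μC S.β0)
    {rr γ₀ β' : ℝ} (hγ₀ : 0 < γ₀) (hrem : RemainderConst S γ₀ rr) (hr : rr ≤ B12Normalization.stepBal N Lc)
    (hβ' : 0 ≤ β') (hcont : BetaContH γ₀ β) (hup : BetaUpperH β' γ₀ β) : EndpointExistence Cn :=
  endpointExistence_of_scalarBounds_avg hgen S hμν hN hL hD hA hδ hwt0 hwt1 hc hM hML (h0_avg_vol hG hg h0T) (h1_avg_vol hG hg h1T)
    (h2_avg_vol hG hg h2T) (d0_avg_vol hG d0T) (d1_avg_vol hG d1T) (d2_avg_vol hG d2T) hU hid hγ₀ hrem hr hβ' hcont hup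

/-- **`EndpointExistence` FROM THE AVERAGE-FIRST SCALAR WALL WITH FINITE-VOLUME GRADED BOUNDS** (RULING (R14-6)) —
`SquareTableAvgFirst.endpointExistence_of_scalarBounds_avgFirst` (an3-g7) with its EIGHT per-base-point `ℤ⁴` bounds
`h0/h1/h1x/h2x/d0/d1/d1x/d2x` replaced by their finite-volume form (`h0_avg_vol`, `h1_avg_vol`, `h1x_vol`, `h2x_vol`, `d0_avg_vol`,
`d1_avg_vol`, `d1x_vol`, `d2x_vol`): the cross shapes involve the two base points `b` and `sh n b` (both in `Bset n` by `hshB`), i.e. a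
fixed linear combination of at most four convergent torus families — the same one-line transfer; the shift structure `(sh, hshB, hwtsh)`
is volume-independent and passes through; every other binder verbatim. [folklore] -/
theorem endpointExistence_of_scalarBounds_avgFirst_vol {β : HBeta} {Cn : B12.Construction} (hgen : ForwardGenerated Cn β)
    (S : B12Beta.OneLoopSplit β) (hμν : μ ≠ ν) {N : ℝ} (hN : N ≠ 0)
    {Lc : ℕ} (hL : 2 ≤ Lc) {μC : ℕ → ℕ → ℝ} {Bset : ℕ → Finset κB} {wt : ℕ → κB → ℝ} {sh : ℕ → Equiv.Perm κB}
    {GT gT : ℕ → κB → ι → Pt → ℝ} {Gf : ℕ → κB → Pt → ℝ} {D A : ℕ → ℝ}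
    (hD : ∀ j, 0 ≤ D j) (hA : ∀ j, 0 ≤ A j) {δ U cc : ℝ} {M : ℕ → ℕ} (hδ : 0 < δ)
    (hwt0 : ∀ n : ℕ, 2 ≤ n → ∀ b ∈ Bset n, 0 ≤ wt n b) (hwt1 : ∀ n : ℕ, 2 ≤ n → ∑ b ∈ Bset n, wt n b = 1)
    (hshB : ∀ n : ℕ, 2 ≤ n → ∀ b, sh n b ∈ Bset n ↔ b ∈ Bset n) (hwtsh : ∀ n : ℕ, 2 ≤ n → ∀ b ∈ Bset n, wt n (sh n b) = wt n b)
    (hc : 1 ≤ cc) (hM : ∀ L : ℕ, 2 ≤ L → 1 ≤ M L ∧ (L : ℝ) ≤ cc * M L) (hML : ∀ L : ℕ, 2 ≤ L → M L ≤ L)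
    (hG : ∀ n : ℕ, 2 ≤ n → ∀ b ∈ Bset n, ∀ v, Tendsto (fun t => GT n b t v) l (𝓝 (Gf n b v)))
    (hg : ∀ n : ℕ, 2 ≤ n → ∀ b ∈ Bset n, ∀ v, Tendsto (fun t => gT n b t v) l (𝓝 (gFree v)))
    (h0T : ∀ n : ℕ, 2 ≤ n → ∀ b ∈ Bset n, ∀ v, ∀ᶠ t in l, |GT n b t v - gT n b t v| ≤ D 0 / (n : ℝ) ^ 2)
    (h1T : ∀ n : ℕ, 2 ≤ n → ∀ b ∈ Bset n, ∀ v (ρ : Fin 4), ∀ᶠ t in l,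
      |(GT n b t (v + unitVec ρ) - gT n b t (v + unitVec ρ)) - (GT n b t v - gT n b t v)| ≤ D 1 / (n : ℝ) ^ 3)
    (h1xT : ∀ n : ℕ, 2 ≤ n → ∀ b ∈ Bset n, ∀ v, ∀ᶠ t in l, |GT n (sh n b) t v - GT n b t v| ≤ D 3 / (n : ℝ) ^ 3)
    (h2xT : ∀ n : ℕ, 2 ≤ n → ∀ b ∈ Bset n, ∀ v, ∀ᶠ t in l,
      |(GT n b t (v + unitVec μ + unitVec ν) - gT n b t (v + unitVec μ + unitVec ν)) -
          (GT n b t (v + unitVec μ) - gT n b t (v + unitVec μ)) -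
          ((GT n (sh n b) t (v + unitVec ν) - gT n (sh n b) t (v + unitVec ν)) - (GT n (sh n b) t v - gT n (sh n b) t v))| ≤
        D 2 / (n : ℝ) ^ 4)
    (d0T : ∀ n : ℕ, 2 ≤ n → ∀ b ∈ Bset n, ∀ v : Pt, v ≠ 0 → ∀ᶠ t in l,
      |GT n b t v| ≤ A 0 * Real.exp (-(δ / n) * supNorm v) / (supNorm v : ℝ) ^ 2)
    (d1T : ∀ n : ℕ, 2 ≤ n → ∀ b ∈ Bset n, ∀ v : Pt, v ≠ 0 → ∀ ρ : Fin 4, ∀ᶠ t in l,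
      |GT n b t (v + unitVec ρ) - GT n b t v| ≤ A 1 * Real.exp (-(δ / n) * supNorm v) / (supNorm v : ℝ) ^ 3)
    (d1xT : ∀ n : ℕ, 2 ≤ n → ∀ b ∈ Bset n, ∀ v : Pt, v ≠ 0 → ∀ᶠ t in l,
      |GT n (sh n b) t v - GT n b t v| ≤ A 3 * Real.exp (-(δ / n) * supNorm v) / (supNorm v : ℝ) ^ 3)
    (d2xT : ∀ n : ℕ, 2 ≤ n → ∀ b ∈ Bset n, ∀ v : Pt, v ≠ 0 → ∀ᶠ t in l,
      |GT n b t (v + unitVec μ + unitVec ν) - GT n b t (v + unitVec μ) - (GT n (sh n b) t (v + unitVec ν) - GT n (sh n b) t v)| ≤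
        A 2 * Real.exp (-(δ / n) * supNorm v) / (supNorm v : ℝ) ^ 4)
    (hU : ∀ m : ℕ, 1 ≤ m → |composedCoeff μC m - ∑ b ∈ Bset (Lc ^ m), wt (Lc ^ m) b * fullSum (stK μ ν N (Gf (Lc ^ m) b))| ≤ U)
    (hid : IdentityForm μC S.β0)
    {rr γ₀ β' : ℝ} (hγ₀ : 0 < γ₀) (hrem : RemainderConst S γ₀ rr) (hr : rr ≤ B12Normalization.stepBal N Lc)
    (hβ' : 0 ≤ β') (hcont : BetaContH γ₀ β) (hup : BetaUpperH β' γ₀ β) : EndpointExistence Cn :=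
  endpointExistence_of_scalarBounds_avgFirst hgen S hμν hN hL hD hA hδ hwt0 hwt1 hshB hwtsh hc hM hML (h0_avg_vol hG hg h0T)
    (h1_avg_vol hG hg h1T) (h1x_vol hshB hG h1xT) (h2x_vol hshB hG hg h2xT) (d0_avg_vol hG d0T) (d1_avg_vol hG d1T)
    (d1x_vol hshB hG d1xT) (d2x_vol hshB hG d2xT) hU hid hγ₀ hrem hr hβ' hcont hup

end EndToEnd

/-! ## §5 Sanity -/

section Examples

/-- CONSTANT-IN-VOLUME families recover `SquareTable` §14's `h0` from its own hypothesis: the finite-volume form is not stronger than the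
`ℤ⁴` form (take `GT n t := Gf n`, `gT n t := gFree`, any non-trivial filter). [folklore] -/
example {Gf : ℕ → Pt → ℝ} {D : ℕ → ℝ} (h0 : ∀ n : ℕ, 2 ≤ n → ∀ v, |Gf n v - gFree v| ≤ D 0 / (n : ℝ) ^ 2) :
    ∀ n : ℕ, 2 ≤ n → ∀ v, |Gf n v - gFree v| ≤ D 0 / (n : ℝ) ^ 2 :=
  h0_vol (l := (atTop : Filter ℕ)) (GT := fun n _ => Gf n) (gT := fun _ _ => gFree) (fun _ _ _ => tendsto_const_nhds)
    (fun _ _ _ => tendsto_const_nhds) (fun n hn v => Eventually.of_forall fun _ => h0 n hn v)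

/-- Along the cubic volumes `N_t = (t, t, t, t)`, `t → ∞`, the torus distance of the class of `v` is eventually `‖v‖_∞`. [folklore] -/
example (v : Pt) : ∀ᶠ t : ℕ in atTop, perSupNorm (fun _ => t) v = supNorm v :=
  eventually_perSupNorm_eq (fun _ => tendsto_id) v

/-- In the fundamental window the two norms agree: period `7` in every direction, `v = (1, −3, 0, 2)`, `2‖v‖_∞ = 6 < 7`. [folklore] -/
example : perSupNorm (fun _ => 7) ![1, -3, 0, 2] = supNorm ![1, -3, 0, 2] :=
  perSupNorm_eq_supNorm fun i => by decide

/-- A bound holding for EVERY volume is in particular an eventual one (how a volume-UNIFORM certificate feeds §2). [folklore] -/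
example {ι : Type*} {l : Filter ι} {u : ι → ℝ} {c : ℝ} (h : ∀ t, |u t| ≤ c) : ∀ᶠ t in l, |u t| ≤ c :=
  Eventually.of_forall h

end Examples

end Literature.MathematicalPhysics.QuantumFieldTheory.Balaban1983to89.Beta.WallVolumeTransfer
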